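import Summits.QuantumAdvantage.QuantumAdvantage.Theorems.SymplecticPurityDeqThesisGoldFlatLemmas

/-!
# Crux `DeqThesis` (stmt-QuantumAdvantage-0242), line `Sketch` v4 — stub `stub_goldFlat`

**Local flatness of the two-Gold-map graph state.** For every finite field `K` of order `2ⁿ`
(`n ≥ 12`), every additive identification `e : K ≃+ 𝔽₂ⁿ`, every layer of one-qubit unitaries `uₖ` and
every non-identity Pauli word `S` on `n + (n + n)` wires,

  `|⟨ĝ₂| ⊗ₖ uₖ σ_{Sₖ} uₖ† |ĝ₂⟩| ≤ 2^{-n}(4 √2ⁿ + 2 √2 · √2ⁿ) ≤ 2^{-n/4}`,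
  `ĝ₂ = (√2ⁿ)⁻¹ Σ_x |x⟩|e((e⁻¹x)³)⟩|e((e⁻¹x)⁵)⟩`

(`stub_goldFlat`, registered stub K5 of the skeleton `Cruxes/DeqThesis/Lines/Sketch.lean` v4; the true
rate is `(4 + 2√2)·2^{-n/2}`, optimal up to the constant). This is the field-level half of the KILL of the
LU-dressed free-frame road `H_LFF`: unlike the single cube graph state of v1–v3 (flat only outside a
doubly-balanced core of T-type tests, `stub_coreBalancedFlat`), the two-Gold-map state is flat against ALL
locally rotated Pauli strings, complex tilts included, by an absolute-value argument:

* expansion `⟨ĝ₂|⊗M|ĝ₂⟩ = 2^{-n} Σ_{x,x'} A(x,x') B₁(F₁x,F₁x') B₂(F₂x,F₂x')` (`graph_dot_tensorAll_mulVec₂`);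
* diagonal `x = x'`: `(∏ diag) · Σ_x (−1)^{mA·x + m₁·[x³] + m₂·[x⁵]}`, `≤ 4√2ⁿ` (`norm_diag_sum_le₂`,
  three-mask Walsh bound `abs_sum_sign_gold_le`: Gold-type / cube / zero);
* off-diagonal classes `x' = x ⊕ d`, `d ≠ 0`: `|A(x,x⊕d)| ≤ w_A(d)` and Cauchy–Schwarz BETWEEN THE TWO
  VALUE REGISTERS (`norm_double_sum_le_cs`) — the differentials `D_d(x³)`, `D_d(x⁵)` are at most `2`- and
  `4`-to-one (`card_filter_cube_xor_le_two`, `card_filter_fifth_xor_le_four`) and the value weights have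
  `Σ_t wᵣ(t)² ≤ 1` (rows of unitaries), so each class is `≤ √2·√4·w_A(d) = 2√2·w_A(d)`, and
  `Σ_d w_A(d) = ∏ᵢ(cᵢ + sᵢ) ≤ √2ⁿ`;
* arithmetic: `2^{-n}(4 + 2√2)√2ⁿ ≤ 8·2^{-n/2} ≤ 2^{-n/4}` for `n ≥ 12` (`final_bound₂`).
-/

set_option linter.dupNamespace false -- D-0017: single-problem summit ⇒ `QuantumAdvantage.QuantumAdvantage` by design

namespace Summit.QuantumAdvantage.QuantumAdvantage.Theorems.SymplecticPurity

open Matrix Finset Literature.Computability.QuantumComplexity Literature.Computability.Cryptography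

namespace GoldFlat

/-! ### The diagonal -/

/-- **The diagonal `x = x'`.** If the diagonal entries of the factors are signs times constants of
modulus `≤ 1`, `M_k(b,b) = D_k (−1)^{m_k b}`, with masks (input, first value, second value register)
not all zero, then `|Σ_x ∏_i M_i(x_i,x_i) ∏_j M_{n+j}((F₁x)_j,(F₁x)_j) ∏_j M_{2n+j}((F₂x)_j,(F₂x)_j)| ≤ 4 √2ⁿ`. -/
theorem norm_diag_sum_le₂ {n : ℕ} {K : Type*} [Field K] [Fintype K] (hK : Fintype.card K = 2 ^ n)
    (e : K ≃+ (Fin n → ZMod 2)) (m : Fin (n + (n + n)) → ZMod 2)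
    (hm : (fun i : Fin n => m (Fin.castAdd (n + n) i)) ≠ 0 ∨
      (fun j : Fin n => m (Fin.natAdd n (Fin.castAdd n j))) ≠ 0 ∨
      (fun j : Fin n => m (Fin.natAdd n (Fin.natAdd n j))) ≠ 0)
    (M : Fin (n + (n + n)) → Matrix Bool Bool ℂ) (Dg : Fin (n + (n + n)) → ℂ) (hD : ∀ k, ‖Dg k‖ ≤ 1)
    (hMd : ∀ k b, M k b b =
      Dg k * ((if m k * (if b then (1 : ZMod 2) else 0) = 0 then (1 : ℝ) else -1 : ℝ) : ℂ))
    (F₁ F₂ : QReg n → QReg n)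
    (hF₁ : ∀ x j, F₁ x j = decide (e ((e.symm fun i : Fin n => if x i then 1 else 0) ^ 3) j = 1))
    (hF₂ : ∀ x j, F₂ x j = decide (e ((e.symm fun i : Fin n => if x i then 1 else 0) ^ 5) j = 1)) :
    ‖∑ x : QReg n, (∏ i : Fin n, M (Fin.castAdd (n + n) i) (x i) (x i)) *
        ((∏ j : Fin n, M (Fin.natAdd n (Fin.castAdd n j)) (F₁ x j) (F₁ x j)) *
          ∏ j : Fin n, M (Fin.natAdd n (Fin.natAdd n j)) (F₂ x j) (F₂ x j))‖ ≤ 4 * Real.sqrt 2 ^ n := by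
  classical
  have hbit₁ : ∀ x j, (if F₁ x j then (1 : ZMod 2) else 0) =
      e ((e.symm fun i : Fin n => if x i then 1 else 0) ^ 3) j := by
    intro x j
    rw [hF₁]
    simp only [decide_eq_true_eq, bit_eq_self]
  have hbit₂ : ∀ x j, (if F₂ x j then (1 : ZMod 2) else 0) =
      e ((e.symm fun i : Fin n => if x i then 1 else 0) ^ 5) j := by
    intro x j
    rw [hF₂]
    simp only [decide_eq_true_eq, bit_eq_self]
  simp only [hMd, hbit₁, hbit₂, Finset.prod_mul_distrib, ← Complex.ofReal_prod, prod_sign_eq,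
    mul_mul_mul_comm, ← Finset.mul_sum, ← Complex.ofReal_mul, sign_mul_sign, ← Complex.ofReal_sum]
  rw [norm_mul, Complex.norm_real, Real.norm_eq_abs]
  have hW := abs_sum_sign_gold_le hK e (fun i => m (Fin.castAdd (n + n) i))
    (fun j => m (Fin.natAdd n (Fin.castAdd n j))) (fun j => m (Fin.natAdd n (Fin.natAdd n j))) hm
  simp_rw [add_assoc] at hW
  have hP : ‖(∏ i : Fin n, Dg (Fin.castAdd (n + n) i)) *
      ((∏ j : Fin n, Dg (Fin.natAdd n (Fin.castAdd n j))) * ∏ j : Fin n, Dg (Fin.natAdd n (Fin.natAdd n j)))‖ ≤ 1 := by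
    rw [norm_mul, norm_mul, norm_prod, norm_prod, norm_prod]
    have h1 : ∀ s : Finset (Fin (n + (n + n))), ∏ k ∈ s, ‖Dg k‖ ≤ 1 := fun s =>
      Finset.prod_le_one (fun _ _ => norm_nonneg _) fun _ _ => hD _
    have hA := Finset.prod_le_one (s := (Finset.univ : Finset (Fin n))) (f := fun i => ‖Dg (Fin.castAdd (n + n) i)‖)
      (fun _ _ => norm_nonneg _) fun _ _ => hD _
    have hB := Finset.prod_le_one (s := (Finset.univ : Finset (Fin n))) (f := fun j => ‖Dg (Fin.natAdd n (Fin.castAdd n j))‖)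
      (fun _ _ => norm_nonneg _) fun _ _ => hD _
    have hC := Finset.prod_le_one (s := (Finset.univ : Finset (Fin n))) (f := fun j => ‖Dg (Fin.natAdd n (Fin.natAdd n j))‖)
      (fun _ _ => norm_nonneg _) fun _ _ => hD _
    exact mul_le_one₀ hA (mul_nonneg (Finset.prod_nonneg fun _ _ => norm_nonneg _)
      (Finset.prod_nonneg fun _ _ => norm_nonneg _)) (mul_le_one₀ hB (Finset.prod_nonneg fun _ _ => norm_nonneg _) hC)
  calc _ ≤ 1 * (4 * Real.sqrt 2 ^ n) := mul_le_mul hP hW (abs_nonneg _) zero_le_one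
    _ = 4 * Real.sqrt 2 ^ n := one_mul _

/-! ### The estimate -/

/-- **Main estimate.** For the weighted two-Gold-map graph vector `g = c Σ_x |x⟩|F₁ x⟩|F₂ x⟩` and a
locally rotated Pauli string `O = ⊗ₖ uₖ σ_{Sₖ} uₖ†`, `S ≠ I`:
`|⟨g| O |g⟩| ≤ |c|² (4 √2ⁿ + 2 √2 · √2ⁿ)`. -/
theorem norm_graph_dot_le₂ {n : ℕ} {K : Type*} [Field K] [Fintype K] (hK : Fintype.card K = 2 ^ n)
    (e : K ≃+ (Fin n → ZMod 2)) (u : Fin (n + (n + n)) → Matrix Bool Bool ℂ)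
    (hu : ∀ i, u i ∈ Matrix.unitaryGroup Bool ℂ) (S : Fin (n + (n + n)) → Pauli)
    (hS : S ≠ fun _ => Pauli.I) (F₁ F₂ : QReg n → QReg n)
    (hF₁ : ∀ x j, F₁ x j = decide (e ((e.symm fun i : Fin n => if x i then 1 else 0) ^ 3) j = 1))
    (hF₂ : ∀ x j, F₂ x j = decide (e ((e.symm fun i : Fin n => if x i then 1 else 0) ^ 5) j = 1))
    (c : ℂ) :
    ‖star (fun w : QReg (n + (n + n)) =>
        if (fun j : Fin (n + n) => w (Fin.natAdd n j)) =
          Fin.append (F₁ (fun i : Fin n => w (Fin.castAdd (n + n) i))) (F₂ (fun i : Fin n => w (Fin.castAdd (n + n) i)))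
        then c else 0) ⬝ᵥ
      (tensorAll (fun i => u i * (S i).mat * star (u i))).mulVec (fun w : QReg (n + (n + n)) =>
        if (fun j : Fin (n + n) => w (Fin.natAdd n j)) =
          Fin.append (F₁ (fun i : Fin n => w (Fin.castAdd (n + n) i))) (F₂ (fun i : Fin n => w (Fin.castAdd (n + n) i)))
        then c else 0)‖ ≤
    ‖c‖ ^ 2 * (4 * Real.sqrt 2 ^ n + 2 * Real.sqrt 2 * Real.sqrt 2 ^ n) := by
  classical
  obtain ⟨M, hM⟩ : ∃ M : Fin (n + (n + n)) → Matrix Bool Bool ℂ, M = fun k => u k * (S k).mat * star (u k) :=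
    ⟨_, rfl⟩
  rw [show (fun i => u i * (S i).mat * star (u i)) = M from hM.symm]
  have hMu : ∀ k, M k ∈ Matrix.unitaryGroup Bool ℂ := fun k => by
    rw [hM]
    exact OneSided.conj_mem_unitaryGroup (hu k) (S k)
  have hMd : ∀ k b, M k b b = M k false false *
      ((if (if S k = Pauli.I then (0 : ZMod 2) else 1) * (if b then (1 : ZMod 2) else 0) = 0
        then (1 : ℝ) else -1 : ℝ) : ℂ) := fun k b => by
    rw [hM]
    exact OneSided.conj_apply_diag (hu k) (S k) b
  -- masks of the three registers are not all zero
  have h10 : (1 : ZMod 2) ≠ 0 := by decide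
  set m : Fin (n + (n + n)) → ZMod 2 := fun k => if S k = Pauli.I then (0 : ZMod 2) else 1 with hmdef
  have hmk : ∀ k, S k ≠ Pauli.I → m k ≠ 0 := fun k hk => by
    simp only [hmdef, hk, if_false]; exact h10
  have hm : (fun i : Fin n => m (Fin.castAdd (n + n) i)) ≠ 0 ∨
      (fun j : Fin n => m (Fin.natAdd n (Fin.castAdd n j))) ≠ 0 ∨
      (fun j : Fin n => m (Fin.natAdd n (Fin.natAdd n j))) ≠ 0 := by
    obtain ⟨k, hk⟩ := Function.ne_iff.1 hS
    by_contra hcon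
    push Not at hcon
    obtain ⟨h1, h2, h3⟩ := hcon
    apply hmk k hk
    induction k using Fin.addCases with
    | left i => exact congrFun h1 i
    | right j' =>
      induction j' using Fin.addCases with
      | left j => exact congrFun h2 j
      | right j => exact congrFun h3 j
  -- the weights of the three registers
  set wA : QReg n → ℝ := fun d => ∏ i : Fin n,
      (if d i then ‖M (Fin.castAdd (n + n) i) false true‖ else ‖M (Fin.castAdd (n + n) i) false false‖) with hwA
  set w₁ : QReg n → ℝ := fun t => ∏ j : Fin n,
      (if t j then ‖M (Fin.natAdd n (Fin.castAdd n j)) false true‖ else ‖M (Fin.natAdd n (Fin.castAdd n j)) false false‖) with hw₁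
  set w₂ : QReg n → ℝ := fun t => ∏ j : Fin n,
      (if t j then ‖M (Fin.natAdd n (Fin.natAdd n j)) false true‖ else ‖M (Fin.natAdd n (Fin.natAdd n j)) false false‖) with hw₂
  -- total mass of the input weight, `ℓ²`-masses of the value weights
  have hWA : ∑ d, wA d ≤ Real.sqrt 2 ^ n := by
    rw [hwA, OneSided.sum_weight_eq_prod (fun i => ‖M (Fin.castAdd (n + n) i) false false‖)
      (fun i => ‖M (Fin.castAdd (n + n) i) false true‖)]
    calc ∏ i : Fin n, (‖M (Fin.castAdd (n + n) i) false false‖ + ‖M (Fin.castAdd (n + n) i) false true‖)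
        ≤ ∏ _i : Fin n, Real.sqrt 2 :=
          Finset.prod_le_prod (fun i _ => by positivity) fun i _ => OneSided.norm_add_norm_le_sqrt_two (hMu _)
      _ = Real.sqrt 2 ^ n := by rw [Finset.prod_const, Finset.card_univ, Fintype.card_fin]
  have hsq : ∀ (N : Fin n → Matrix Bool Bool ℂ), (∀ j, N j ∈ Matrix.unitaryGroup Bool ℂ) →
      ∑ t : QReg n, (∏ j : Fin n, (if t j then ‖N j false true‖ else ‖N j false false‖)) ^ 2 ≤ 1 := by
    intro N hN
    have hre : ∀ t : QReg n, (∏ j : Fin n, (if t j then ‖N j false true‖ else ‖N j false false‖)) ^ 2 =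
        ∏ j : Fin n, (if t j then ‖N j false true‖ ^ 2 else ‖N j false false‖ ^ 2) := by
      intro t
      rw [← Finset.prod_pow]
      exact Finset.prod_congr rfl fun j _ => by split_ifs <;> rfl
    simp_rw [hre]
    rw [OneSided.sum_weight_eq_prod (fun j => ‖N j false false‖ ^ 2) (fun j => ‖N j false true‖ ^ 2)]
    refine Finset.prod_le_one (fun j _ => by positivity) fun j _ => ?_
    have := OneSided.norm_sq_row_of_unitary (hN j) false
    linarith
  have hW₁ : ∑ t, w₁ t ^ 2 ≤ 1 := hsq (fun j => M (Fin.natAdd n (Fin.castAdd n j))) fun j => hMu _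
  have hW₂ : ∑ t, w₂ t ^ 2 ≤ 1 := hsq (fun j => M (Fin.natAdd n (Fin.natAdd n j))) fun j => hMu _
  -- the expansion: value register of `n + n` wires, split into its two halves
  rw [graph_dot_tensorAll_mulVec₂ (fun x => Fin.append (F₁ x) (F₂ x)) M c _ rfl, norm_mul, norm_mul,
    norm_star, ← sq]
  refine mul_le_mul_of_nonneg_left ?_ (sq_nonneg _)
  have hsplit : ∀ x x' : QReg n, (∏ j : Fin (n + n), M (Fin.natAdd n j) (Fin.append (F₁ x) (F₂ x) j)
      (Fin.append (F₁ x') (F₂ x') j)) =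
      (∏ j : Fin n, M (Fin.natAdd n (Fin.castAdd n j)) (F₁ x j) (F₁ x' j)) *
        ∏ j : Fin n, M (Fin.natAdd n (Fin.natAdd n j)) (F₂ x j) (F₂ x' j) := by
    intro x x'
    rw [Fin.prod_univ_add]
    simp only [Fin.append_left, Fin.append_right]
  simp_rw [hsplit]
  refine (norm_double_sum_le_cs
    (fun x x' => ∏ i : Fin n, M (Fin.castAdd (n + n) i) (x i) (x' i))
    (fun y y' => ∏ j : Fin n, M (Fin.natAdd n (Fin.castAdd n j)) (y j) (y' j))
    (fun y y' => ∏ j : Fin n, M (Fin.natAdd n (Fin.natAdd n j)) (y j) (y' j)) F₁ F₂ wA w₁ w₂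
    (4 * Real.sqrt 2 ^ n) 2 4
    (fun x x' => (OneSided.norm_prod_entry (fun i => M (Fin.castAdd (n + n) i)) (fun i => hMu _) x x').le)
    (fun y y' => (OneSided.norm_prod_entry (fun j => M (Fin.natAdd n (Fin.castAdd n j))) (fun j => hMu _) y y').le)
    (fun y y' => (OneSided.norm_prod_entry (fun j => M (Fin.natAdd n (Fin.natAdd n j))) (fun j => hMu _) y y').le)
    (fun d => Finset.prod_nonneg fun i _ => by positivity)
    (fun t => Finset.prod_nonneg fun j _ => by positivity) hW₁ hW₂
    (norm_diag_sum_le₂ hK e m hm M (fun k => M k false false)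
      (fun k => entry_norm_bound_of_unitary (hMu k) _ _) hMd F₁ F₂ hF₁ hF₂)
    (OneSided.card_filter_cube_xor_le_two hK e F₁ hF₁)
    (card_filter_fifth_xor_le_four hK e F₂ hF₂)).trans ?_
  have h4 : Real.sqrt (4 : ℕ) = 2 := by
    rw [show ((4 : ℕ) : ℝ) = 2 ^ 2 by norm_num, Real.sqrt_sq (by norm_num : (0 : ℝ) ≤ 2)]
  have h2 : Real.sqrt (2 : ℕ) = Real.sqrt 2 := by norm_num
  rw [h4, h2]
  have h0 : 0 ≤ Real.sqrt 2 := Real.sqrt_nonneg _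
  nlinarith

/-- **Final arithmetic**: `2^{-n} (4 √2ⁿ + 2 √2 · √2ⁿ) ≤ 2^{-n/4}` for `n ≥ 12`. -/
theorem final_bound₂ (n : ℕ) (hn : 12 ≤ n) :
    ‖((Real.sqrt 2 : ℂ) ^ n)⁻¹‖ ^ 2 * (4 * Real.sqrt 2 ^ n + 2 * Real.sqrt 2 * Real.sqrt 2 ^ n) ≤
      (2 : ℝ) ^ (-(1 / 4 * (n : ℝ))) := by
  have h2 : (0 : ℝ) < 2 := by norm_num
  have hs2 : Real.sqrt 2 ≤ 3 / 2 := by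
    rw [Real.sqrt_le_left (by norm_num)]
    norm_num
  have hpow : ∀ m : ℕ, Real.sqrt 2 ^ m = (2 : ℝ) ^ ((m : ℝ) / 2) := by
    intro m
    rw [Real.sqrt_eq_rpow, ← Real.rpow_natCast, ← Real.rpow_mul h2.le]
    congr 1
    ring
  have hnorm : ‖((Real.sqrt 2 : ℂ) ^ n)⁻¹‖ ^ 2 = (2 : ℝ) ^ (-(n : ℝ)) := by
    rw [norm_inv, norm_pow, Complex.norm_real, Real.norm_of_nonneg (Real.sqrt_nonneg _), inv_pow,
      ← pow_mul, pow_mul', Real.sq_sqrt h2.le, Real.rpow_neg h2.le, Real.rpow_natCast]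
  have hn' : (12 : ℝ) ≤ n := by exact_mod_cast hn
  have hE : (2 : ℝ) ^ (-(n : ℝ)) * Real.sqrt 2 ^ n = 2 ^ (-(n : ℝ) / 2) := by
    rw [hpow n, ← Real.rpow_add h2]
    congr 1
    ring
  -- `2^{-n} (4 + 2√2) √2ⁿ ≤ 7 · 2^{-n/2} ≤ 2³ · 2^{-n/2} = 2^{3 - n/2} ≤ 2^{-n/4}`
  calc ‖((Real.sqrt 2 : ℂ) ^ n)⁻¹‖ ^ 2 * (4 * Real.sqrt 2 ^ n + 2 * Real.sqrt 2 * Real.sqrt 2 ^ n)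
      = (4 + 2 * Real.sqrt 2) * ((2 : ℝ) ^ (-(n : ℝ)) * Real.sqrt 2 ^ n) := by rw [hnorm]; ring
    _ ≤ 8 * (2 : ℝ) ^ (-(n : ℝ) / 2) := by
        rw [hE]
        have : (0 : ℝ) ≤ (2 : ℝ) ^ (-(n : ℝ) / 2) := (Real.rpow_pos_of_pos h2 _).le
        nlinarith
    _ = (2 : ℝ) ^ ((3 : ℝ) + -(n : ℝ) / 2) := by
        rw [Real.rpow_add h2, show (2 : ℝ) ^ (3 : ℝ) = 8 by norm_num]
    _ ≤ 2 ^ (-(1 / 4 * (n : ℝ))) := Real.rpow_le_rpow_of_exponent_le one_le_two (by linarith)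

end GoldFlat

/-- **Stub `stub_goldFlat`** of the line `Sketch` (skeleton v4) of crux `DeqThesis`
(stmt-QuantumAdvantage-0242): the normalised TWO-GOLD-MAP graph state
`2^{-n/2} Σ_x |x⟩|e((e⁻¹x)³)⟩|e((e⁻¹x)⁵)⟩` is `2^{-n/4}`-flat (for `n ≥ 12`; in fact `(4+2√2)·2^{-n/2}`)
against EVERY locally rotated Pauli string `⊗ₖ uₖ σ_{Sₖ} uₖ†`, `S ≠ I` — every field `K` of order `2ⁿ`,
every additive identification `e`, arbitrary one-qubit unitaries `uₖ` (complex tilts included).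
Pairing `x' = x ⊕ d`: the diagonal is a Gold-type Walsh sum (`≤ 4√2ⁿ`), and every off-diagonal class
is `≤ 2√2 · w_A(d)` by Cauchy–Schwarz between the two value registers (differential fibres `≤ 2`, `≤ 4`),
with `Σ_d w_A(d) ≤ √2ⁿ`. No doubly-balanced core remains. -/
theorem stub_goldFlat :
    ∃ δ : ℝ, 0 < δ ∧ ∃ n₀ : ℕ, ∀ n ≥ n₀, ∀ (K : Type) [Field K] [Fintype K], Fintype.card K = 2 ^ n →
      ∀ e : K ≃+ (Fin n → ZMod 2),
      ∀ u : Fin (n + (n + n)) → Matrix Bool Bool ℂ, (∀ i, u i ∈ Matrix.unitaryGroup Bool ℂ) →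
        ∀ S : Fin (n + (n + n)) → Pauli, S ≠ (fun _ => Pauli.I) →
          ‖star (fun w : QReg (n + (n + n)) =>
                if (fun j : Fin (n + n) => w (Fin.natAdd n j)) =
                    Fin.append
                      (fun l : Fin n => decide (e ((e.symm (fun i : Fin n => if w (Fin.castAdd (n + n) i) then 1 else 0)) ^ 3) l = 1))
                      (fun l : Fin n => decide (e ((e.symm (fun i : Fin n => if w (Fin.castAdd (n + n) i) then 1 else 0)) ^ 5) l = 1))
                then ((Real.sqrt 2 ^ n)⁻¹ : ℂ) else 0) ⬝ᵥ
              (tensorAll (fun i => u i * (S i).mat * star (u i))).mulVec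
                (fun w : QReg (n + (n + n)) =>
                if (fun j : Fin (n + n) => w (Fin.natAdd n j)) =
                    Fin.append
                      (fun l : Fin n => decide (e ((e.symm (fun i : Fin n => if w (Fin.castAdd (n + n) i) then 1 else 0)) ^ 3) l = 1))
                      (fun l : Fin n => decide (e ((e.symm (fun i : Fin n => if w (Fin.castAdd (n + n) i) then 1 else 0)) ^ 5) l = 1))
                then ((Real.sqrt 2 ^ n)⁻¹ : ℂ) else 0)‖
            ≤ (2 : ℝ) ^ (-(δ * (n : ℝ))) := by
  refine ⟨1 / 4, by norm_num, 12, ?_⟩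
  intro n hn K _ _ hK e u hu S hS
  refine le_trans (GoldFlat.norm_graph_dot_le₂ hK e u hu S hS
    (fun x j => decide (e ((e.symm fun i : Fin n => if x i then 1 else 0) ^ 3) j = 1))
    (fun x j => decide (e ((e.symm fun i : Fin n => if x i then 1 else 0) ^ 5) j = 1))
    (fun x j => rfl) (fun x j => rfl) _) ?_
  exact GoldFlat.final_bound₂ n hn

end Summit.QuantumAdvantage.QuantumAdvantage.Theorems.SymplecticPurity
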